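import Literature.NumberTheory.DiophantineGeometry.AbcWave0GranvilleStarkHeightProofs
import Literature.NumberTheory.DiophantineGeometry.AbcWave0SiegelZerosProofs
import Literature.NumberTheory.QuadraticFields.DedekindZetaReducedForms
import Literature.NumberTheory.QuadraticFields.QuadraticDedekindZetaOddPrimitive
import HarnessLib

/-!
# Granville–Stark, eq. (11): `h(−d)(L'/L(1, χ_{−d}) + ½ log d) = (π/6)√d ∑ 1/a + O(∑ log(√d/a))`, proved;
# hence abc.S22 from the data of Lemma 1 alone

Topic `Literature/NumberTheory/DiophantineGeometry`; a proofs-only companion (theorems only, no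
definitions, no named facts) of `AbcWave0.lean`, `AbcWave0GranvilleStarkProofs.lean` (the glue
`granville_stark_noSiegelZeros_of_thm1_of_eq11`) and `AbcWave0GranvilleStarkHeightProofs.lean` (Theorem 1
from uniform abc and the data of Lemma 1; the join
`granville_stark_noSiegelZeros_of_lemma1Data_of_eq11`). Here the remaining analytic hypothesis `eq11` of
that join — Granville–Stark, *ABC implies no "Siegel zeros"*, Invent. Math. 139 (2000), §3.2,
eq. (11), "which follows from Selberg–Chowla [12] and Dirichlet's class number formula" — is PROVED:

* `riemannZeta_mul_LFunction_eq_half_sum` — for `χ` primitive quadratic odd mod `d > 4` and real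
  `s > 1`: `ζ(s) L(s, χ) = ½ ∑_{Q ∈ reducedForms(−d)} Z_Q(s)` (the imaginary quadratic field `K` with
  `d_K = −d` exists, `ζ_K = ζ · L(·, χ)` by the decomposition law and the identification of `χ` with the
  Kronecker symbol, and `ζ_K = ½ ∑_Q Z_Q` over the reduced forms: `QuadraticDedekindZetaOddPrimitive.lean`,
  `DedekindZetaReducedForms.lean`);
* `LFunction_one_eq` — **Dirichlet's class number formula** `L(1, χ) = π h(−d)/√d` (residues at
  `s = 1`: `Z_Q` has residue `2π/√d`, `ζ` has residue `1`);
* `deriv_LFunction_one_add_eq` — `L'(1, χ) + γ L(1, χ) = ½ ∑_Q C_Q` with `C_Q` the constant terms of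
  the `Z_Q` at `s = 1` (Kronecker's limit formula, bounded form:
  `KroneckerLimit.exists_norm_constantTerm_sub_le`, `C_Q = π²/(3a) − (2π/√d) log(d/a) + O(1/√d)`);
* `granvilleStark_eq11` — **eq. (11)**: there are `A₀` and `d₀` with
  `|h(−d)(Re L'/L(1, χ) + ½ log d) − (π/6)√d ∑_Q 1/a_Q| ≤ A₀ ∑_Q log(√d/a_Q)` for all `d ≥ d₀` and all
  odd real primitive `χ` mod `d` (indeed the left side equals `∑_Q (−log(√d/a) − γ + O(1))`, and
  `log(√d/a) ≥ ½ log 3` for reduced forms);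
* `granville_stark_noSiegelZeros_of_lemma1Data` — **abc.S22 from the data of Lemma 1**:
  `granville_stark_noSiegelZeros` (`UniformABCConjecture → NoSiegelZerosOddQuadratic`,
  [GranvilleStark2000, Theorem 2]) follows from the single remaining classical input, the data of
  Granville–Stark's Lemma 1 (for every `d` carrying an odd real primitive character, a number field
  `K ∋ γ₂, γ₃`, `γ₂³ = j(τ_{−d}) = γ₃² + 1728`, with `|D_K| ≤ (36d)^{[K:ℚ]/2}` — Weber functions, Shimura
  reciprocity, the conductor–discriminant formula), by `granville_stark_noSiegelZeros_of_lemma1Data_of_eq11`.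

## References

* [GranvilleStark2000] A. Granville, H. M. Stark, Invent. Math. 139 (2000), 509–523: §3.2 eq. (11)
  and Theorem 3, §3.1 Remark 1, Theorem 2.
* A. Selberg, S. Chowla, J. reine angew. Math. 227 (1967), 86–110 (p. 109), cited through
  [GranvilleStark2000].
* [MontgomeryVaughan2007] §10.1 Exercise 26, Theorem 9.13; [Cox2013] Thm. 7.7.
-/

noncomputable section

open Filter Topology Complex Finset
open Literature.Barriers.RiemannHypothesis (epsteinZeta IsPosDefForm starkK)
open Literature.NumberTheory.QuadraticFields

namespace Literature.NumberTheory.DiophantineGeometry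

open Literature.NumberTheory.LFunctions.PrimitiveQuadratic
  Literature.NumberTheory.QuadraticFields.BinaryQuadraticForm

/-! ### The reduced forms of discriminant `−d` as real positive definite forms -/

/-- The data of a reduced form `Q = (a, b, c)` of discriminant `−d` as a real form: positive
definite, `4ac − b² = d`, `e^{−2πκ} ≤ ½`, `log(√d/a) ≥ ½ log 3`, `a > 0`. [folklore] -/
theorem reducedForm_real_data {d : ℕ} (hd : 0 < d) {Q : ℤ × ℤ × ℤ} (hQ : Q ∈ reducedForms (-(d : ℤ))) :
    IsPosDefForm (Q.1 : ℝ) (Q.2.1 : ℝ) (Q.2.2 : ℝ) ∧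
      (4 * (Q.1 : ℝ) * Q.2.2 - (Q.2.1 : ℝ) ^ 2 = d) ∧
      Real.exp (-(2 * Real.pi * starkK (Q.1 : ℝ) (Q.2.1 : ℝ) (Q.2.2 : ℝ))) ≤ 1 / 2 ∧
      Real.log 3 / 2 ≤ Real.log (Real.sqrt d / (Q.1 : ℝ)) ∧ 0 < (Q.1 : ℝ) := by
  have hD : (-(d : ℤ)) < 0 := by omega
  obtain ⟨hdisc, ha, -, hred⟩ := (mem_reducedForms_iff hD).1 hQ
  obtain ⟨h1, h3⟩ := one_le_and_three_mul_sq_le_of_mem_reducedForms hd hQ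
  rw [discr] at hdisc
  have hdiscR : 4 * (Q.1 : ℝ) * Q.2.2 - (Q.2.1 : ℝ) ^ 2 = d := by
    have : ((Q.2.1 ^ 2 - 4 * Q.1 * Q.2.2 : ℤ) : ℝ) = ((-(d : ℤ) : ℤ) : ℝ) := by rw [hdisc]
    push_cast at this
    linarith
  have haR : (0 : ℝ) < Q.1 := by exact_mod_cast ha
  have hdpos : (0 : ℝ) < d := by exact_mod_cast hd
  have hpos : IsPosDefForm (Q.1 : ℝ) (Q.2.1 : ℝ) (Q.2.2 : ℝ) := ⟨haR, by linarith⟩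
  obtain ⟨hb1, hb2, hac, -⟩ := hred
  have hba : |(Q.2.1 : ℝ)| ≤ Q.1 := by
    rw [abs_le]
    exact ⟨by exact_mod_cast hb1, by exact_mod_cast hb2⟩
  have hacR : (Q.1 : ℝ) ≤ Q.2.2 := by exact_mod_cast hac
  refine ⟨hpos, hdiscR, KroneckerLimit.exp_neg_two_pi_starkK_le_half hpos hba hacR, ?_, haR⟩
  -- `√d/a ≥ √3`
  have h3R : 3 * (Q.1 : ℝ) ^ 2 ≤ d := by exact_mod_cast h3
  have hsq : Real.sqrt 3 * Q.1 ≤ Real.sqrt d := by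
    rw [show Real.sqrt 3 * Q.1 = Real.sqrt (3 * (Q.1 : ℝ) ^ 2) by
      rw [Real.sqrt_mul (by norm_num), Real.sqrt_sq haR.le]]
    exact Real.sqrt_le_sqrt h3R
  have hle : Real.sqrt 3 ≤ Real.sqrt d / Q.1 := by rwa [le_div_iff₀ haR]
  calc Real.log 3 / 2 = Real.log (Real.sqrt 3) := by rw [Real.log_sqrt (by norm_num)]
    _ ≤ Real.log (Real.sqrt d / Q.1) :=
        Real.log_le_log (Real.sqrt_pos.mpr (by norm_num)) hle

/-! ### `ζ(s) L(s, χ) = ½ ∑_Q Z_Q(s)` -/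

/-- **`ζ(s) L(s, χ) = ½ ∑_{Q ∈ reducedForms(−d)} Z_Q(s)`** for `χ` primitive, quadratic and odd mod
`d > 4` and real `s > 1`: with the imaginary quadratic field `K` of discriminant `−d`
(`exists_quadraticField_of_odd_primitive`), `ζ(s) L(s, χ) = ζ_K(s)`
(`dedekindZeta_eq_riemannZeta_mul_LFunction_of_odd_primitive`) and `ζ_K(s) = ½ ∑_Q Z_Q(s)`
(`dedekindZeta_eq_half_sum_epsteinZeta`). Granville–Stark §3.2 (Selberg–Chowla summed over the
reduced forms). [cite: GranvilleStark2000, §3.2] -/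
theorem riemannZeta_mul_LFunction_eq_half_sum {d : ℕ} [NeZero d] (hd : 4 < d)
    {χ : DirichletCharacter ℂ d} (hprim : χ.IsPrimitive) (hquad : χ.IsQuadratic) (hodd : χ.Odd)
    {s : ℝ} (hs : 1 < s) :
    riemannZeta s * χ.LFunction s =
      1 / 2 * ∑ Q ∈ reducedForms (-(d : ℤ)), epsteinZeta (Q.1 : ℝ) (Q.2.1 : ℝ) (Q.2.2 : ℝ) s := by
  obtain ⟨K, _i1, _i2, h2, hdisc⟩ := Quadratic.exists_quadraticField_of_odd_primitive hprim hquad hodd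
  have hs' : 1 < ((s : ℂ)).re := by simpa using hs
  have hd4 : NumberField.discr K < -4 := by rw [hdisc]; omega
  rw [← Quadratic.dedekindZeta_eq_riemannZeta_mul_LFunction_of_odd_primitive hprim hquad hodd h2 hdisc hs',
    Quadratic.dedekindZeta_eq_half_sum_epsteinZeta h2 hd4 hs', hdisc]

/-! ### Dirichlet's class number formula `L(1, χ) = π h(−d)/√d` -/

/-- **Dirichlet's class number formula for odd real primitive characters**: for `χ` primitive,
quadratic and odd mod `d > 4`, `L(1, χ) = π h(−d)/√d`, `h(−d)` the number of reduced forms of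
discriminant `−d`. Proof: multiply `ζ(s)L(s, χ) = ½∑_Q Z_Q(s)` by `s − 1` and let `s → 1⁺`:
`(s−1)ζ(s) → 1` (Mathlib), `(s−1)Z_Q(s) → 2π/√d` (`KroneckerLimit.tendsto_sub_one_mul_epsteinZeta`).
Granville–Stark §3.2: "`L(1, χ_d) = π h(−d)/√d` if `d > 4`". [cite: GranvilleStark2000, §3.2] -/
theorem LFunction_one_eq {d : ℕ} [NeZero d] (hd : 4 < d) {χ : DirichletCharacter ℂ d}
    (hprim : χ.IsPrimitive) (hquad : χ.IsQuadratic) (hodd : χ.Odd) :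
    χ.LFunction 1 = ((Real.pi * classNumber (-(d : ℤ)) / Real.sqrt d : ℝ) : ℂ) := by
  have hd0 : 0 < d := by omega
  have hχ1 := ne_one_of_odd hodd
  have hLc : ContinuousAt χ.LFunction 1 :=
    (DirichletCharacter.differentiable_LFunction hχ1).continuous.continuousAt
  have hL : Tendsto (fun s : ℝ => χ.LFunction s) (𝓝[>] 1) (𝓝 (χ.LFunction 1)) := by
    have := hLc.tendsto.comp ((Complex.continuous_ofReal.tendsto (1 : ℝ)).mono_left
      (nhdsWithin_le_nhds (s := Set.Ioi (1 : ℝ))))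
    exact this
  -- left side: `(s−1)ζ(s)L(s) → L(1)`
  have hζ : Tendsto (fun s : ℝ => ((s : ℂ) - 1) * riemannZeta s) (𝓝[>] 1) (𝓝 1) :=
    riemannZeta_residue_one.comp Quadratic.tendsto_ofReal_nhdsGT_one
  have hlhs : Tendsto (fun s : ℝ => ((s : ℂ) - 1) * (riemannZeta s * χ.LFunction s)) (𝓝[>] 1)
      (𝓝 (1 * χ.LFunction 1)) :=
    (hζ.mul hL).congr fun s => by ring
  -- right side: `(s−1) ½∑ Z_Q(s) → ½ ∑ 2π/√d`
  set r : ℝ := 2 * Real.pi / Real.sqrt d with hr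
  have hrhs : Tendsto (fun s : ℝ => ((s : ℂ) - 1) *
      (1 / 2 * ∑ Q ∈ reducedForms (-(d : ℤ)), epsteinZeta (Q.1 : ℝ) (Q.2.1 : ℝ) (Q.2.2 : ℝ) s))
      (𝓝[>] 1) (𝓝 (1 / 2 * ∑ Q ∈ reducedForms (-(d : ℤ)), (r : ℂ))) := by
    have hsum : Tendsto (fun s : ℝ => ∑ Q ∈ reducedForms (-(d : ℤ)),
        ((s : ℂ) - 1) * epsteinZeta (Q.1 : ℝ) (Q.2.1 : ℝ) (Q.2.2 : ℝ) s) (𝓝[>] 1)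
        (𝓝 (∑ Q ∈ reducedForms (-(d : ℤ)), (r : ℂ))) := by
      refine tendsto_finsetSum _ fun Q hQ => ?_
      obtain ⟨hpos, h4, -⟩ := reducedForm_real_data hd0 hQ
      have := KroneckerLimit.tendsto_sub_one_mul_epsteinZeta hpos
      rwa [h4] at this
    refine (hsum.const_mul (1 / 2 : ℂ)).congr fun s => ?_
    rw [Finset.mul_sum, Finset.mul_sum, Finset.mul_sum]
    refine Finset.sum_congr rfl fun Q _ => by ring
  -- the two sides agree on `(1, ∞)`
  have heq : (fun s : ℝ => ((s : ℂ) - 1) * (riemannZeta s * χ.LFunction s)) =ᶠ[𝓝[>] 1]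
      fun s : ℝ => ((s : ℂ) - 1) *
        (1 / 2 * ∑ Q ∈ reducedForms (-(d : ℤ)), epsteinZeta (Q.1 : ℝ) (Q.2.1 : ℝ) (Q.2.2 : ℝ) s) := by
    filter_upwards [self_mem_nhdsWithin] with s hs
    rw [riemannZeta_mul_LFunction_eq_half_sum hd hprim hquad hodd hs]
  have hlim := tendsto_nhds_unique (hlhs.congr' heq) hrhs
  rw [one_mul] at hlim
  rw [hlim, Finset.sum_const, nsmul_eq_mul, classNumber, hr]
  push_cast
  ring

/-! ### The constant terms: `L'(1, χ) + γ L(1, χ) = ½ ∑_Q C_Q` -/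

/-- The difference quotient of `L(·, χ)` at `1` along `s → 1⁺` tends to `L'(1, χ)`. [folklore] -/
theorem tendsto_slope_LFunction {d : ℕ} [NeZero d] {χ : DirichletCharacter ℂ d} (hχ1 : χ ≠ 1) :
    Tendsto (fun s : ℝ => (χ.LFunction s - χ.LFunction 1) / ((s : ℂ) - 1)) (𝓝[>] 1)
      (𝓝 (deriv χ.LFunction 1)) := by
  have hD := hasDerivAt_iff_tendsto_slope.mp
    ((DirichletCharacter.differentiable_LFunction hχ1 1).hasDerivAt)
  refine (hD.comp Quadratic.tendsto_ofReal_nhdsGT_one).congr fun s => ?_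
  simp only [Function.comp_apply, slope_def_field]

/-- **The constant term at `s = 1`: `L'(1, χ) + γ L(1, χ) = ½ ∑_Q C_Q`**, where `C_Q` is the constant
term of `Z_Q` at `1` (`Z_Q(s) − (2π/√d)/(s−1) → C_Q` as `s → 1⁺`), for `χ` primitive, quadratic and
odd mod `d > 4`. Proof: subtract `L(1, χ)/(s − 1) = ½∑_Q (2π/√d)/(s−1)` (class number formula) from
`ζ(s)L(s, χ) = ½∑_Q Z_Q(s)` and let `s → 1⁺`, using `ζ(s) − 1/(s−1) → γ` (Mathlib). This is the
comparison of constant terms behind Granville–Stark's (11) ("Taking the derivatives of both sides of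
their formula at `s = 1`"). [cite: GranvilleStark2000, §3.2] -/
theorem deriv_LFunction_one_add_eq {d : ℕ} [NeZero d] (hd : 4 < d) {χ : DirichletCharacter ℂ d}
    (hprim : χ.IsPrimitive) (hquad : χ.IsQuadratic) (hodd : χ.Odd) {CT : ℤ × ℤ × ℤ → ℂ}
    (hCT : ∀ Q ∈ reducedForms (-(d : ℤ)), Tendsto (fun s : ℝ => epsteinZeta (Q.1 : ℝ) (Q.2.1 : ℝ) (Q.2.2 : ℝ) s
      - ((2 * Real.pi / Real.sqrt d : ℝ) : ℂ) / ((s : ℂ) - 1)) (𝓝[>] 1) (𝓝 (CT Q))) :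
    deriv χ.LFunction 1 + (Real.eulerMascheroniConstant : ℂ) * χ.LFunction 1 =
      1 / 2 * ∑ Q ∈ reducedForms (-(d : ℤ)), CT Q := by
  have hd0 : 0 < d := by omega
  have hχ1 := ne_one_of_odd hodd
  set ℓ : ℂ := χ.LFunction 1 with hℓ
  have hℓval := LFunction_one_eq hd hprim hquad hodd
  set r : ℝ := 2 * Real.pi / Real.sqrt d with hr
  -- `ℓ = ½ h r`
  have hℓr : ℓ = 1 / 2 * ∑ Q ∈ reducedForms (-(d : ℤ)), (r : ℂ) := by
    rw [hℓ, hℓval, Finset.sum_const, nsmul_eq_mul, classNumber, hr]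
    push_cast
    ring
  -- left side: `(ζ(s) − 1/(s−1)) L(s) + (L(s) − ℓ)/(s−1) → γ ℓ + L'(1)`
  have hLc : ContinuousAt χ.LFunction 1 :=
    (DirichletCharacter.differentiable_LFunction hχ1).continuous.continuousAt
  have hL : Tendsto (fun s : ℝ => χ.LFunction s) (𝓝[>] 1) (𝓝 ℓ) := by
    have := hLc.tendsto.comp ((Complex.continuous_ofReal.tendsto (1 : ℝ)).mono_left
      (nhdsWithin_le_nhds (s := Set.Ioi (1 : ℝ))))
    exact this
  have hζ : Tendsto (fun s : ℝ => riemannZeta s - 1 / ((s : ℂ) - 1)) (𝓝[>] 1)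
      (𝓝 (Real.eulerMascheroniConstant : ℂ)) :=
    tendsto_riemannZeta_sub_one_div.comp Quadratic.tendsto_ofReal_nhdsGT_one
  have hlhs : Tendsto (fun s : ℝ => (riemannZeta s - 1 / ((s : ℂ) - 1)) * χ.LFunction s +
      (χ.LFunction s - ℓ) / ((s : ℂ) - 1)) (𝓝[>] 1)
      (𝓝 ((Real.eulerMascheroniConstant : ℂ) * ℓ + deriv χ.LFunction 1)) :=
    (hζ.mul hL).add (tendsto_slope_LFunction hχ1)
  -- right side
  have hrhs : Tendsto (fun s : ℝ => 1 / 2 * ∑ Q ∈ reducedForms (-(d : ℤ)),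
      (epsteinZeta (Q.1 : ℝ) (Q.2.1 : ℝ) (Q.2.2 : ℝ) s - (r : ℂ) / ((s : ℂ) - 1))) (𝓝[>] 1)
      (𝓝 (1 / 2 * ∑ Q ∈ reducedForms (-(d : ℤ)), CT Q)) :=
    (tendsto_finsetSum _ fun Q hQ => hCT Q hQ).const_mul _
  -- they agree on `(1, ∞)`
  have heq : (fun s : ℝ => (riemannZeta s - 1 / ((s : ℂ) - 1)) * χ.LFunction s +
      (χ.LFunction s - ℓ) / ((s : ℂ) - 1)) =ᶠ[𝓝[>] 1]
      fun s : ℝ => 1 / 2 * ∑ Q ∈ reducedForms (-(d : ℤ)),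
        (epsteinZeta (Q.1 : ℝ) (Q.2.1 : ℝ) (Q.2.2 : ℝ) s - (r : ℂ) / ((s : ℂ) - 1)) := by
    filter_upwards [self_mem_nhdsWithin] with s hs
    have hne : (s : ℂ) - 1 ≠ 0 := by
      rw [sub_ne_zero, ← Complex.ofReal_one, Ne, Complex.ofReal_inj]
      exact ne_of_gt hs
    have hid := riemannZeta_mul_LFunction_eq_half_sum hd hprim hquad hodd hs
    rw [Finset.sum_sub_distrib, mul_sub, ← hid, ← Finset.sum_div, ← mul_div_assoc, ← hℓr]
    field_simp
    ring
  have hlim := tendsto_nhds_unique (hlhs.congr' heq) hrhs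
  rw [← hlim]
  ring

/-! ### Eq. (11) -/

/-- **Granville–Stark, eq. (11)** (from Selberg–Chowla and Dirichlet's class number formula): there
are absolute constants `A₀`, `d₀` such that for every `d ≥ d₀` and every odd real primitive character
`χ` mod `d`,
`|h(−d)·(Re L'/L(1, χ) + ½ log d) − (π/6)√d ∑_{Q reduced} 1/a_Q| ≤ A₀ ∑_{Q reduced} log(√d/a_Q)`,
with `h(−d)` the number of reduced forms of discriminant `−d`. Indeed the left side is
`|∑_Q (−log(√d/a_Q) − γ + (√d/2π) Re(C_Q − M_Q))|` with `|C_Q − M_Q| ≤ C/√d` (Kronecker's limit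
formula, `M_Q = π²/(3a) − (2π/√d) log(d/a)`), and `log(√d/a_Q) ≥ ½ log 3` for reduced forms; so
`A₀ = 1 + (C/2π + γ)/(½ log 3)` and `d₀ = 5` work. Printed form: "(11)
`h(−d) = {π/3 + O(·)}(1 + (2/log d) L'/L(1, χ_d))⁻¹ (√d/log d) ∑ 1/a`" with the error term (12);
we prove the weaker `O(∑ log(√d/a))` form that the deduction of Theorem 2 uses
(`granville_stark_noSiegelZeros_of_thm1_of_eq11`). [cite: GranvilleStark2000, §3.2 eq. (11)] -/
theorem granvilleStark_eq11 :
    ∃ A₀ : ℝ, ∃ d₀ : ℕ, ∀ (d : ℕ) [NeZero d], d₀ ≤ d → ∀ χ : DirichletCharacter ℂ d,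
      χ.IsQuadratic → χ.IsPrimitive → χ.Odd →
        |(classNumber (-(d : ℤ)) : ℝ) * ((deriv χ.LFunction 1 / χ.LFunction 1).re + Real.log d / 2) -
            Real.pi / 6 * Real.sqrt d * ∑ Q ∈ reducedForms (-(d : ℤ)), (1 : ℝ) / (Q.1 : ℝ)| ≤
          A₀ * ∑ Q ∈ reducedForms (-(d : ℤ)), Real.log (Real.sqrt d / (Q.1 : ℝ)) := by
  obtain ⟨C, hC⟩ := KroneckerLimit.exists_norm_constantTerm_sub_le
  set C' : ℝ := max C 0 with hC'
  have hC'0 : 0 ≤ C' := le_max_right _ _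
  set γ : ℝ := Real.eulerMascheroniConstant with hγ
  have hγ0 : 0 ≤ γ := (one_half_pos.trans Real.one_half_lt_eulerMascheroniConstant).le
  set B : ℝ := C' / (2 * Real.pi) + γ with hB
  have hB0 : 0 ≤ B := by positivity
  refine ⟨1 + B / (Real.log 3 / 2), 5, ?_⟩
  intro d _ hd χ hquad hprim hodd
  have hd4 : 4 < d := by omega
  have hd0 : 0 < d := by omega
  have hdR : (0 : ℝ) < d := by exact_mod_cast hd0
  have hsq : 0 < Real.sqrt d := Real.sqrt_pos.mpr hdR
  set red := reducedForms (-(d : ℤ)) with hred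
  set r : ℝ := 2 * Real.pi / Real.sqrt d with hr
  -- the constant terms `CT Q` with their bounds
  have hdata : ∀ Q ∈ red, ∃ CT : ℂ, Tendsto (fun s : ℝ => epsteinZeta (Q.1 : ℝ) (Q.2.1 : ℝ) (Q.2.2 : ℝ) s
        - (r : ℂ) / ((s : ℂ) - 1)) (𝓝[>] 1) (𝓝 CT) ∧
      ‖CT - ((Real.pi ^ 2 / (3 * Q.1) - r * Real.log (d / Q.1) : ℝ) : ℂ)‖ ≤ C / Real.sqrt d := by
    intro Q hQ
    obtain ⟨hpos, h4, hexp, -⟩ := reducedForm_real_data hd0 hQ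
    have := hC _ _ _ hpos hexp
    rw [h4] at this
    exact this
  classical
  set CT : ℤ × ℤ × ℤ → ℂ := fun Q => if h : Q ∈ red then Classical.choose (hdata Q h) else 0 with hCTdef
  have hCT : ∀ Q ∈ red, Tendsto (fun s : ℝ => epsteinZeta (Q.1 : ℝ) (Q.2.1 : ℝ) (Q.2.2 : ℝ) s
        - (r : ℂ) / ((s : ℂ) - 1)) (𝓝[>] 1) (𝓝 (CT Q)) ∧
      ‖CT Q - ((Real.pi ^ 2 / (3 * Q.1) - r * Real.log (d / Q.1) : ℝ) : ℂ)‖ ≤ C / Real.sqrt d := by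
    intro Q hQ
    simp only [hCTdef, dif_pos hQ]
    exact Classical.choose_spec (hdata Q hQ)
  -- `L(1)` and `L'(1)`
  set h : ℝ := (classNumber (-(d : ℤ)) : ℝ) with hh
  have hh_card : (red.card : ℝ) = h := by rw [hh, classNumber]
  have hh0 : 0 < h := by
    rw [hh]
    exact_mod_cast classNumber_pos (by omega) (neg_emod_four_of_odd hprim hquad hodd)
  set ℓ : ℝ := Real.pi * h / Real.sqrt d with hℓ
  have hℓ0 : 0 < ℓ := by positivity
  have hL1 : χ.LFunction 1 = (ℓ : ℂ) := by
    rw [LFunction_one_eq hd4 hprim hquad hodd, hℓ, hh]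
  have hder := deriv_LFunction_one_add_eq hd4 hprim hquad hodd (CT := CT) fun Q hQ => (hCT Q hQ).1
  rw [hL1] at hder
  -- the real error terms `e Q = Re (CT Q − M Q)`
  set M : ℤ × ℤ × ℤ → ℝ := fun Q => Real.pi ^ 2 / (3 * Q.1) - r * Real.log (d / Q.1) with hM
  set e : ℤ × ℤ × ℤ → ℝ := fun Q => (CT Q - (M Q : ℂ)).re with he
  have he_bound : ∀ Q ∈ red, |e Q| ≤ C' / Real.sqrt d := by
    intro Q hQ
    calc |e Q| ≤ ‖CT Q - (M Q : ℂ)‖ := Complex.abs_re_le_norm _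
      _ ≤ C / Real.sqrt d := (hCT Q hQ).2
      _ ≤ C' / Real.sqrt d := by gcongr; exact le_max_left _ _
  have hreCT : ∀ Q, (CT Q).re = M Q + e Q := by
    intro Q
    simp only [he, Complex.sub_re, Complex.ofReal_re]
    ring
  -- `Re L'(1) = ½ ∑ (M + e) − γ ℓ`
  have hre : (deriv χ.LFunction 1).re = 1 / 2 * ∑ Q ∈ red, (M Q + e Q) - γ * ℓ := by
    have h1 : deriv χ.LFunction 1 = 1 / 2 * ∑ Q ∈ red, CT Q - (γ : ℂ) * ℓ := by
      rw [← hder]; ring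
    rw [h1]
    simp only [Complex.sub_re, Complex.mul_re, Complex.re_sum, Complex.ofReal_re, Complex.ofReal_im,
      Complex.div_ofNat_re, Complex.div_ofNat_im, Complex.one_re, Complex.one_im, hreCT, mul_zero,
      zero_mul, sub_zero, zero_div]
    try norm_num
    try ring
  have hquot : (deriv χ.LFunction 1 / χ.LFunction 1).re = (1 / 2 * ∑ Q ∈ red, (M Q + e Q) - γ * ℓ) / ℓ := by
    rw [hL1, Complex.div_ofReal_re, hre]
  -- the identity behind (11)
  have hlogQ : ∀ Q ∈ red, Real.log ((d : ℝ) / Q.1) = Real.log (Real.sqrt d / Q.1) + Real.log d / 2 := by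
    intro Q hQ
    obtain ⟨-, -, -, -, ha⟩ := reducedForm_real_data hd0 hQ
    rw [Real.log_div hdR.ne' ha.ne', Real.log_div hsq.ne' ha.ne', Real.log_sqrt hdR.le]
    ring
  have hsumM : ∑ Q ∈ red, M Q = Real.pi ^ 2 / 3 * ∑ Q ∈ red, (1 : ℝ) / (Q.1 : ℝ) -
      r * (∑ Q ∈ red, Real.log (Real.sqrt d / (Q.1 : ℝ)) + h / 2 * Real.log d) := by
    rw [Finset.mul_sum, ← hh_card]
    have : ∑ Q ∈ red, Real.log (Real.sqrt d / (Q.1 : ℝ)) + (red.card : ℝ) / 2 * Real.log d =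
        ∑ Q ∈ red, (Real.log (Real.sqrt d / (Q.1 : ℝ)) + Real.log d / 2) := by
      rw [Finset.sum_add_distrib, Finset.sum_const, nsmul_eq_mul]
      ring
    rw [this, Finset.mul_sum, ← Finset.sum_sub_distrib]
    refine Finset.sum_congr rfl fun Q hQ => ?_
    rw [hM]
    simp only
    rw [hlogQ Q hQ]
    ring
  have hkey : h * ((deriv χ.LFunction 1 / χ.LFunction 1).re + Real.log d / 2) -
      Real.pi / 6 * Real.sqrt d * ∑ Q ∈ red, (1 : ℝ) / (Q.1 : ℝ) =
      ∑ Q ∈ red, (-Real.log (Real.sqrt d / (Q.1 : ℝ)) + Real.sqrt d / (2 * Real.pi) * e Q - γ) := by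
    rw [hquot, Finset.sum_add_distrib, hsumM]
    have hsum3 : ∑ Q ∈ red, (-Real.log (Real.sqrt d / (Q.1 : ℝ)) + Real.sqrt d / (2 * Real.pi) * e Q - γ) =
        -∑ Q ∈ red, Real.log (Real.sqrt d / (Q.1 : ℝ)) + Real.sqrt d / (2 * Real.pi) * ∑ Q ∈ red, e Q
          - h * γ := by
      rw [Finset.sum_sub_distrib, Finset.sum_add_distrib, Finset.sum_neg_distrib, ← Finset.mul_sum,
        Finset.sum_const, nsmul_eq_mul, hh_card]
    rw [hsum3, hℓ, hr]
    have hπ := Real.pi_pos.ne'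
    have hsq' := hsq.ne'
    field_simp
    ring
  rw [hkey]
  -- the estimate, term by term
  have hterm : ∀ Q ∈ red, |(-Real.log (Real.sqrt d / (Q.1 : ℝ)) + Real.sqrt d / (2 * Real.pi) * e Q - γ)| ≤
      (1 + B / (Real.log 3 / 2)) * Real.log (Real.sqrt d / (Q.1 : ℝ)) := by
    intro Q hQ
    obtain ⟨-, -, -, hlog, -⟩ := reducedForm_real_data hd0 hQ
    set L := Real.log (Real.sqrt d / (Q.1 : ℝ)) with hL
    have hL0 : 0 < L := lt_of_lt_of_le (by positivity) hlog
    have hx : |Real.sqrt d / (2 * Real.pi) * e Q| ≤ C' / (2 * Real.pi) := by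
      rw [abs_mul, abs_of_pos (by positivity)]
      calc Real.sqrt d / (2 * Real.pi) * |e Q| ≤ Real.sqrt d / (2 * Real.pi) * (C' / Real.sqrt d) :=
            mul_le_mul_of_nonneg_left (he_bound Q hQ) (by positivity)
        _ = C' / (2 * Real.pi) := by field_simp
    have hBL : B ≤ B / (Real.log 3 / 2) * L := by
      rw [div_mul_eq_mul_div, le_div_iff₀ (by positivity)]
      exact mul_le_mul_of_nonneg_left hlog hB0
    calc |(-L + Real.sqrt d / (2 * Real.pi) * e Q - γ)|
        ≤ |(-L + Real.sqrt d / (2 * Real.pi) * e Q)| + |γ| := abs_sub _ _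
      _ ≤ |(-L)| + |Real.sqrt d / (2 * Real.pi) * e Q| + |γ| := by
          gcongr
          exact abs_add_le _ _
      _ = L + |Real.sqrt d / (2 * Real.pi) * e Q| + γ := by
          rw [abs_neg, abs_of_pos hL0, abs_of_nonneg hγ0]
      _ ≤ L + C' / (2 * Real.pi) + γ := by gcongr
      _ = L + B := by rw [hB]; ring
      _ ≤ L + B / (Real.log 3 / 2) * L := by linarith [hBL]
      _ = (1 + B / (Real.log 3 / 2)) * L := by ring
  calc |∑ Q ∈ red, (-Real.log (Real.sqrt d / (Q.1 : ℝ)) + Real.sqrt d / (2 * Real.pi) * e Q - γ)|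
      ≤ ∑ Q ∈ red, |(-Real.log (Real.sqrt d / (Q.1 : ℝ)) + Real.sqrt d / (2 * Real.pi) * e Q - γ)| :=
        Finset.abs_sum_le_sum_abs _ _
    _ ≤ ∑ Q ∈ red, (1 + B / (Real.log 3 / 2)) * Real.log (Real.sqrt d / (Q.1 : ℝ)) :=
        Finset.sum_le_sum hterm
    _ = (1 + B / (Real.log 3 / 2)) * ∑ Q ∈ red, Real.log (Real.sqrt d / (Q.1 : ℝ)) := by
        rw [Finset.mul_sum]

/-! ### abc.S22 from the data of Lemma 1 -/

open _root_.Literature.NumberTheory.EllipticCurves NumberField in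
/-- **abc.S22 from the data of Granville–Stark's Lemma 1.** `granville_stark_noSiegelZeros`
(`UniformABCConjecture → NoSiegelZerosOddQuadratic`; [GranvilleStark2000, Theorem 2]) follows from the
single classical input `hdata`: for every `d` carrying an odd real primitive character, a number field
`K ∋ γ₂, γ₃` (algebraic integers with `γ₂³ = j(τ_{−d})`, `γ₃² = j(τ_{−d}) − 1728`) with
`|D_K| ≤ (36d)^{[K:ℚ]/2}` — the conclusion of Lemma 1 ("`Δ_K ≤ 6√d`" for `K = ℚ(√−d)(γ₂(τ), γ₃(τ))`,
from Shimura reciprocity and the conductor–discriminant formula) together with the integrality of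
`j(τ)` (Weber; Cox Thm. 11.1). Everything else — the height argument of §2
(`granville_stark_thm1_of_lemma1Data`), eq. (11) of §3.2 (`granvilleStark_eq11`, this file) and the
deduction of Theorem 2 (`granville_stark_noSiegelZeros_of_thm1_of_eq11`) — is proved.
[cite: GranvilleStark2000, Theorem 2 with Lemma 1, Theorem 1, eq. (11)] -/
theorem granville_stark_noSiegelZeros_of_lemma1Data
    (hdata : ∀ (d : ℕ) [NeZero d],
      (∃ χ : DirichletCharacter ℂ d, χ.IsQuadratic ∧ χ.IsPrimitive ∧ χ.Odd) →
        ∃ (K : Type) (_ : Field K) (_ : NumberField K) (ι : K →+* ℂ) (g₂ g₃ : 𝓞 K),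
          ι (g₂ : K) ^ 3 = formJ (principalForm (-(d : ℤ))) ∧
          ι (g₃ : K) ^ 2 = formJ (principalForm (-(d : ℤ))) - 1728 ∧
          |(NumberField.discr K : ℝ)| ≤ (36 * (d : ℝ)) ^ ((Module.finrank ℚ K : ℝ) / 2)) :
    granville_stark_noSiegelZeros :=
  granville_stark_noSiegelZeros_of_lemma1Data_of_eq11 hdata granvilleStark_eq11

end Literature.NumberTheory.DiophantineGeometry
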